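import Literature.NumberTheory.Rogawski1990.UnitStableOrbitalIntegralHSideValueTypeTwo   -- ★ B-p10 (g24): `exists_rescaled_cyclicFrame`, `ncard_selfDualStable_antidiagTwo_eq_sum_of_unitary`, the place API
import Literature.NumberTheory.Automorphic.PlaneLatticesCompanionScalarReductionCount     -- ★ B-p08 (g27) p842649: `ncard_selfDualStable_scalarReduction_antidiag_companion_eq_sum`
import Literature.NumberTheory.Automorphic.SelfDualLatticeScalarReductionTransport        -- ★ B-p08 (g28) p842998 FILE A: refined transport, refined fixed-coset dictionary, 2×2 ∕ reduction dictionary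
import Literature.NumberTheory.Automorphic.UnitaryTwoIwahoriEdgeCountFibrewiseTypeTwo     -- ★ B-p08 (g28) FILE B1: the type-(2) star value, the fibrewise count, the predicate bridge (brings ★ (R3b)(R3c)(R5a), ★ FILE A)
import Literature.NumberTheory.Automorphic.UnitaryGroupIntegralPointsReductionInert        -- ★ `exists_residueField_ringHom_galAdicCompletionMap`, `residueHom_galAdicCompletionMap_eq_pow`, `natCard_residueField_eq_sq_of_inert`
import HarnessLib

/-!
# Kottwitz's EDGE COUNT for a TYPE-(2) elliptic element of `U(Φ₂)(L⁺_v)` at an inert place: `#Fix_γ(U_w ⧸ I_w) + 1 = 2·Σ_{k ≤ N} q_v^k`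
(modulo the two Iwahori-star values)

Topic `NumberTheory/Rogawski1990`; namespace `Literature.NumberTheory.Automorphic.UnitaryGroup`.  THEOREMS ONLY (no definition, no instance, no notation, no named
fact, no `sorry`).  Cell `pub/hodgecm-mathlib` (D-0151), crux H413 = `stmt-HodgeConjecture-24833`, line «N6nsGerm», stub `stub_N6nsR2EP : RankOneEulerPoincareNonsplit`
((R2) = [Kottwitz1988 §2 Thm. 2] on the tree of `U(1,1)`; EP pen B-p04 (g34), LEAD F0P3a-plan (g10) WORD T9-8 (C)); brick (R2-t2) «TYPE-(2) EDGE COUNT», FILE B = the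
HEAD, FILE B2 (B-p08 (g28), census `B-provers/B-p08/g28/CENSUS-R2t2-E2-assembly.B-p08g28.md`; generic star values in FILE B1 `Automorphic/UnitaryTwoIwahoriEdgeCountFibrewiseTypeTwo`).  HONEST LABEL: HC_CM is proved only modulo the cell's remaining named inputs
(hLiu418, h413) until rung 0 closes; (R2) is a printed theorem — this file prices ONE count of its unramified in-house road and asserts nothing printed.

THE MATHEMATICS (Kottwitz 1988 §2; Serre, *Trees* II.1.1).  `v` a finite place of `L⁺` inert and unramified in the CM field `L`, `w ∣ v`, `σ_w` the conjugation of
`L_w`, `q = q_v` (`|𝓀_w| = q²`), `ϖ = ι_w(ϖ_v)`.  ONE-PLACE TOKENS (the EP pen's E-PLAN (b)): `U_w := U(σ_w, (Φ₂)_w) ≤ GL₂(L_w)`, `K_w := U_w ∩ GL₂(𝒪)`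
(`(glInt 2 L_w).subgroupOf U_w`), `I_w := U_w ∩ Iwahori` (`(iwahoriGL 2 L_w).subgroupOf U_w`), `I_w ≤ K_w`.  A TYPE-(2) elliptic `γ ∈ U_w` (`χ_γ` without root in `L_w`,
`tr γ ∈ 𝒪`, `|2| = 1`, `|tr² − 4 det| = |ϖ^{2N+1}|`) fixes `P := Σ_{k≤N} q^k` vertices of each type (★ `ncard_selfDualStable_antidiagTwo_eq_sum_of_unitary`: the ball of radius
`N + ½` about an edge midpoint).  Its fixed EDGES `E₂ := #Fix_γ(U_w ⧸ I_w)` are counted over the fixed `K_w`-vertices `x` by the fixed points of the LOCAL MONODROMY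
`k_x := (out x)⁻¹ γ (out x) ∈ K_w` on the star `K_w ⧸ I_w` (★ p842457).  By the 2×2 dictionary (★ FILE A: `(k_x − c·1)² = ((tr² − 4det)∕4)·1`, `c := tr γ∕2`) the reduction
`k̄_x` is the SCALAR `c̄` or a TRANSVECTION `c̄ + n̄` (`n̄ ≠ 0 = n̄²`), with `c̄` of residual norm one (★ FILE B1 `map_half_trace_mul_sub_one_eq`); the scalar locus has
`s := Σ_{k<N} q^k` elements (§3, ★ p842649 through the REFINED frame transport of ★ FILE A along the rescaled isotropic cyclic frame ★ `exists_rescaled_cyclicFrame`).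
With the two STAR VALUES `q + 1` (scalar) and `1` (transvection) — the EP pen's (R3c), entering here as the named binders `hstar₁`, `hstar₂` in ★ p842457's fibre currency —
**`E₂ + 1 = (q+1)·s + (P − s) + 1 = P + q·s + 1 = 2P`** (`P = q·s + 1`).  With `V_K = V_{K′} = P` (B-p10 (i) similitude transport) this is the Euler characteristic
`V_K + V_{K′} − E₂ = 1` of the fixed subtree, the type-(2) elliptic row of (R2).

* §2 `ncard_selfDualStable_scalarReduction_antidiag_companion_eq_sum_at` — ★ p842649 at the place `w` (the form as a binder `hH`, to be `subst`ed).
* §3 **`ncard_selfDualStable_scalarReduction_antidiagTwo_eq_sum_of_unitary`** — `#{Λ ∈ S((Φ₂)_w, γ) | (γ − c·1)·Λ ≤ ϖ·Λ} = Σ_{k<N} q^k`, and the group-side reading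
  **`natCard_fixedBy_subtype_scalar_eq_sum_of_unitary`** — `#{x ∈ Fix_γ(U_w ⧸ K_w) | k_x ≡ c·1 (mod ϖ)} = Σ_{k<N} q^k`; `natCard_fixedBy_glInt_eq_sum_of_unitary` — `#Fix_γ(U_w ⧸ K_w) = Σ_{k≤N} q^k`.
* §5 **`natCard_fixedBy_iwahori_add_one_eq_two_mul_sum_of_not_exists_isRoot`** — THE HEAD (★ FILE B1's fibrewise count at `a = tr γ∕2`, `e = (tr² − 4det)∕4`).
ELABORATION NOTE (for the next hand at this place): never `rw` under the refined set-builder or next to the place-level fixed-coset subtypes (motive checks exhaust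
the default heartbeats) — forms are handed over as binders (`hH`, `subst`), sets compared by `and_congr_left'` after `ext`, existentials split by `rcases h with ⟨P', hP'⟩`
+ projections, and counts substituted in term mode (`congr`/`congrArg`) before `omega`.

## References
* [Kottwitz1988] R. E. Kottwitz, *Tamagawa numbers*, Ann. of Math. 127 (1988), 629–646, §2 Theorem 2 (Euler–Poincaré functions; `O_γ(f_EP) = χ(X^γ)`).
* [Serre1980Trees] J.-P. Serre, *Trees* (1980), Ch. II §1.1 (the tree of `SL₂`; the star of a vertex), Ch. I §6.
* [Rogawski1990] J. D. Rogawski, *Automorphic Representations of Unitary Groups in Three Variables* (1990), §3.6 p. 31, §4.9 p. 55, §12.6 p. 174.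
* [Flicker1998UnitaryFL] Y. Z. Flicker, *Elementary proof of the fundamental lemma for a unitary group*, Canad. J. Math. 50 (1998), §6 p. 97.
* [IwahoriMatsumoto1965] N. Iwahori, H. Matsumoto, Publ. Math. IHÉS 25 (1965), §2 (Iwahori subgroup, reduction mod `𝔓`).
-/

set_option autoImplicit false

noncomputable section

open MeasureTheory NumberField IsDedekindDomain Matrix Finset ValuativeRel
open scoped ValuativeRel Matrix MatrixGroups

namespace Literature.NumberTheory.Automorphic.UnitaryGroup

open Literature.NumberTheory.Rogawski1990

/-! ## §2 ★ p842649 at the place `w` -/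

section AtPlace

variable (L : Type) [Field L] [NumberField L] [IsCMField L] (v : HeightOneSpectrum (𝓞 ↥(maximalRealSubfield L)))
  (w : PlacesOver L v) (hw : IsCMField.complexConj L • w.1 = w.1)

include hw in
/-- **THE INTERIOR COUNT AT `w`** — ★ `ncard_selfDualStable_scalarReduction_antidiag_companion_eq_sum` at `F := L_w`, `σ := σ_w`, `ϖ := ι_w(ϖ_v)`: for `t, d, β ∈ L_w` with
`|t| ≤ 1`, `|2| = 1`, `|β| = |ϖ^e|` (`e ≤ 1`), `|t² − 4d| = |ϖ^(2N+1)|`, `β σt + σβ t = 0`, `↑γ = !![0, −d; 1, t]`, `|d| = 1`: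
`#{Λ ∈ S(H, γ) | (γ − (t∕2)·1)·Λ ≤ ϖ·Λ} = Σ_(k < N) q_v^k` for `H = !![0, β; σβ, 0]` (the form is a binder `hH` so that consumers `subst` instead of rewriting inside the
set — rewriting under the refined set-builder at the place exhausts the default heartbeats; inert instance block of ★ `ncard_selfDualStable_antidiag_companion_eq_sum_at` verbatim).
[cite: Flicker1998UnitaryFL, §6 p. 97] [cite: Kottwitz1988, §2] -/
theorem ncard_selfDualStable_scalarReduction_antidiag_companion_eq_sum_at (hunr : Algebra.IsUnramifiedIn (𝓞 L) v.asIdeal)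
    (h2 : valuation (w.1.adicCompletion L) 2 = 1) {t d β : (w.1.adicCompletion L)} (ht : t ∈ 𝒪[(w.1.adicCompletion L)]) (hd : valuation (w.1.adicCompletion L) d = 1)
    {e : ℕ} (he : e ≤ 1) (hβ : valuation (w.1.adicCompletion L) β = valuation (w.1.adicCompletion L) ((toPlace v w (GaloisRepresentations.HeckeCharacter.uniformizer ↥(maximalRealSubfield L) v : v.adicCompletion ↥(maximalRealSubfield L))) ^ e)) {N : ℕ}
    (hD : valuation (w.1.adicCompletion L) (t ^ 2 - 4 * d) = valuation (w.1.adicCompletion L) ((toPlace v w (GaloisRepresentations.HeckeCharacter.uniformizer ↥(maximalRealSubfield L) v : v.adicCompletion ↥(maximalRealSubfield L))) ^ (2 * N + 1)))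
    (htr : β * (galAdicCompletionMap (L := L) (IsCMField.complexConj L) hw) t + (galAdicCompletionMap (L := L) (IsCMField.complexConj L) hw) β * t = 0)
    {H : Matrix (Fin 2) (Fin 2) (w.1.adicCompletion L)} (hH : H = !![0, β; (galAdicCompletionMap (L := L) (IsCMField.complexConj L) hw) β, 0])
    (γ : GL (Fin 2) (w.1.adicCompletion L)) (hγ : (γ : Matrix (Fin 2) (Fin 2) (w.1.adicCompletion L)) = !![0, -d; 1, t]) :
    {Λ : Submodule 𝒪[(w.1.adicCompletion L)] (Fin 2 → (w.1.adicCompletion L)) |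
        ((∃ g : GL (Fin 2) (w.1.adicCompletion L), (∃ J' ∈ glInt 2 (w.1.adicCompletion L), (J' : Matrix (Fin 2) (Fin 2) (w.1.adicCompletion L)) = formCongr (galAdicCompletionMap (L := L) (IsCMField.complexConj L) hw) g H) ∧
          Λ = Submodule.span 𝒪[(w.1.adicCompletion L)] (Set.range ((g : Matrix (Fin 2) (Fin 2) (w.1.adicCompletion L)))ᵀ)) ∧
        Λ.map ((Matrix.toLin' (γ : Matrix (Fin 2) (Fin 2) (w.1.adicCompletion L))).restrictScalars 𝒪[(w.1.adicCompletion L)]) = Λ) ∧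
        Λ.map ((Matrix.toLin' ((γ : Matrix (Fin 2) (Fin 2) (w.1.adicCompletion L)) - (t * 2⁻¹) • (1 : Matrix (Fin 2) (Fin 2) (w.1.adicCompletion L)))).restrictScalars 𝒪[(w.1.adicCompletion L)]) ≤
          Λ.map ((Matrix.toLin' ((toPlace v w (GaloisRepresentations.HeckeCharacter.uniformizer ↥(maximalRealSubfield L) v : v.adicCompletion ↥(maximalRealSubfield L)) : (w.1.adicCompletion L)) • (1 : Matrix (Fin 2) (Fin 2) (w.1.adicCompletion L)))).restrictScalars 𝒪[(w.1.adicCompletion L)])}.ncard =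
      ∑ k ∈ range N, Nat.card (𝓞 ↥(maximalRealSubfield L) ⧸ v.asIdeal) ^ k := by
  classical
  subst hH
  have hc1 : IsCMField.complexConj L ≠ 1 := IsCMField.complexConj_ne_one L
  have hϖv := Liu2021.LemD1IndexedNonVacuityInertCofinite.valued_toPlace_uniformizer_of_isUnramifiedIn L v hunr w
  have hϖ : IsUniformizingElement (toPlace v w (GaloisRepresentations.HeckeCharacter.uniformizer ↥(maximalRealSubfield L) v : v.adicCompletion ↥(maximalRealSubfield L))) := isUniformizingElement_of_v_eq hϖv
  haveI : IsDiscreteValuationRing 𝒪[(w.1.adicCompletion L)] := isDiscreteValuationRing_integer_of_compatible hϖv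
  have hσO : ∀ x : 𝒪[(w.1.adicCompletion L)], (galAdicCompletionMap (L := L) (IsCMField.complexConj L) hw) x ∈ 𝒪[(w.1.adicCompletion L)] := mem_integer_galAdicCompletionMap (IsCMField.complexConj L) v w hw
  let σO : 𝒪[(w.1.adicCompletion L)] →+* 𝒪[(w.1.adicCompletion L)] := ((galAdicCompletionMap (L := L) (IsCMField.complexConj L) hw).comp (𝒪[(w.1.adicCompletion L)]).subtype).codRestrict 𝒪[(w.1.adicCompletion L)] fun x => hσO x
  have hσO' : ∀ x : 𝒪[(w.1.adicCompletion L)], ((σO x : 𝒪[(w.1.adicCompletion L)]) : (w.1.adicCompletion L)) = (galAdicCompletionMap (L := L) (IsCMField.complexConj L) hw) x := fun _ => rfl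
  have hσσ : ∀ x, σO (σO x) = x := fun x =>
    Subtype.ext (galAdicCompletionMap_galAdicCompletionMap_of_smul_eq (IsCMField.complexConj L) w hc1 hw (x : (w.1.adicCompletion L)))
  have hσϖ : (galAdicCompletionMap (L := L) (IsCMField.complexConj L) hw) (toPlace v w (GaloisRepresentations.HeckeCharacter.uniformizer ↥(maximalRealSubfield L) v : v.adicCompletion ↥(maximalRealSubfield L))) = (toPlace v w (GaloisRepresentations.HeckeCharacter.uniformizer ↥(maximalRealSubfield L) v : v.adicCompletion ↥(maximalRealSubfield L))) := galAdicCompletionMap_toPlace (IsCMField.complexConj L) w w hw _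
  have hσv : ∀ x, valuation (w.1.adicCompletion L) ((galAdicCompletionMap (L := L) (IsCMField.complexConj L) hw) x) = valuation (w.1.adicCompletion L) x := fun x => valuation_galAdicCompletionMap_eq (IsCMField.complexConj L) v w hw x
  obtain ⟨σk, hσk⟩ := exists_residueField_ringHom_galAdicCompletionMap (IsCMField.complexConj L) v w hw
  have hq : Nat.card 𝓀[(w.1.adicCompletion L)] = Nat.card (𝓞 ↥(maximalRealSubfield L) ⧸ v.asIdeal) ^ 2 := natCard_residueField_eq_sq_of_inert (IsCMField.complexConj L) v hc1 hunr w hw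
  letI : Fintype 𝓀[(w.1.adicCompletion L)] := Fintype.ofFinite _
  have hq' : Fintype.card 𝓀[(w.1.adicCompletion L)] = Nat.card (𝓞 ↥(maximalRealSubfield L) ⧸ v.asIdeal) ^ 2 := by rw [← Nat.card_eq_fintype_card, hq]
  obtain ⟨a₀, ha₀⟩ := LocalFields.UnramifiedQuadraticNorm.exists_isUnit_map_sub_of_residueHom_ne (galAdicCompletionMap (L := L) (IsCMField.complexConj L) hw) hσO σk hσk
    (Literature.LinearAlgebra.Matrix.exists_frob_ne hq' σk (residueHom_galAdicCompletionMap_eq_pow (IsCMField.complexConj L) v hc1 hunr w hw σk hσO hσk))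
  have ha₀' : IsUnit (σO a₀ - a₀) := ha₀
  exact ncard_selfDualStable_scalarReduction_antidiag_companion_eq_sum hϖ (galAdicCompletionMap (L := L) (IsCMField.complexConj L) hw) σO hσO' hσσ hσϖ hσv h2 ht hd he hβ hD htr γ hγ ha₀' hq

end AtPlace

/-! ## §3 The refined count at `w`: lattices and fixed cosets -/

section Count

variable (L : Type) [Field L] [NumberField L] [IsCMField L] (v : HeightOneSpectrum (𝓞 ↥(maximalRealSubfield L)))
  (w : PlacesOver L v) (hw : IsCMField.complexConj L • w.1 = w.1)

omit [IsCMField L] in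
/-- `(Φ₂)_w = !![0, 1; 1, 0]` (entries `0, 1` under `algebraMap`). [cite: Rogawski1990, §3.6 p. 31] -/
theorem placeForm_antidiagTwo_eq_antidiag :
    placeForm (Matrix.of fun i j : Fin 2 => if i.val + j.val + 1 = 2 then (1 : L) else 0) w.1 = (!![0, 1; 1, 0] : Matrix (Fin 2) (Fin 2) (w.1.adicCompletion L)) := by
  ext i j
  fin_cases i <;> fin_cases j <;> simp [placeForm, Matrix.map_apply]

set_option maxHeartbeats 400000 in
include hw in
/-- **THE REFINED LATTICE COUNT AT `w` FOR A TYPE-(2) UNITARY MATRIX**: for `g ∈ GL₂(L_w)` unitary for `(Φ₂)_w`, `χ_g` without root in `L_w`, `tr g ∈ 𝒪`, `|2| = 1`,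
`|tr² − 4 det| = exp(−(2N+1))`: `#{Λ ∈ S((Φ₂)_w, g) | (g − (tr g∕2)·1)·Λ ≤ ϖ·Λ} = Σ_(k < N) q_v^k` — the INTERIOR vertices of the fixed ball (those at which `g` reduces to the
scalar `tr g∕2`).  Proof: ★ `exists_rescaled_cyclicFrame` (isotropic cyclic frame, Gram `antidiag(a²g₁₀, σ(a²g₁₀))`, element the companion `C(tr, det)`), the REFINED transport ★
`ncard_selfDualStable_subSmul_congr`, and §2. [cite: Kottwitz1988, §2] [cite: Flicker1998UnitaryFL, §6 p. 97] -/
theorem ncard_selfDualStable_scalarReduction_antidiagTwo_eq_sum_of_unitary (hunr : Algebra.IsUnramifiedIn (𝓞 L) v.asIdeal)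
    (gGL : GL (Fin 2) (w.1.adicCompletion L)) (g : Matrix (Fin 2) (Fin 2) (w.1.adicCompletion L)) (hcoe : (gGL : Matrix (Fin 2) (Fin 2) (w.1.adicCompletion L)) = g)
    (hgU : (g.map (galAdicCompletionMap (L := L) (IsCMField.complexConj L) hw))ᵀ * (!![0, 1; 1, 0] : Matrix (Fin 2) (Fin 2) (w.1.adicCompletion L)) * g = !![0, 1; 1, 0])
    (h2v : valuation (w.1.adicCompletion L) 2 = 1) (ht : g.trace ∈ 𝒪[(w.1.adicCompletion L)])
    (hirr : ¬ ∃ x : (w.1.adicCompletion L), (g.charpoly).IsRoot x)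
    (N : ℕ) (hN : Valued.v (g.trace ^ 2 - 4 * g.det) = WithZero.exp (-((2 * N + 1 : ℕ) : ℤ))) :
    {Λ : Submodule 𝒪[(w.1.adicCompletion L)] (Fin 2 → (w.1.adicCompletion L)) |
        ((∃ g' : GL (Fin 2) (w.1.adicCompletion L), (∃ J' ∈ glInt 2 (w.1.adicCompletion L), (J' : Matrix (Fin 2) (Fin 2) (w.1.adicCompletion L)) =
            formCongr (galAdicCompletionMap (L := L) (IsCMField.complexConj L) hw) g' (placeForm (Matrix.of fun i j : Fin 2 => if i.val + j.val + 1 = 2 then (1 : L) else 0) w.1)) ∧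
          Λ = Submodule.span 𝒪[(w.1.adicCompletion L)] (Set.range ((g' : Matrix (Fin 2) (Fin 2) (w.1.adicCompletion L)))ᵀ)) ∧
        Λ.map ((Matrix.toLin' ((gGL : GL (Fin 2) (w.1.adicCompletion L)) : Matrix (Fin 2) (Fin 2) (w.1.adicCompletion L))).restrictScalars 𝒪[(w.1.adicCompletion L)]) = Λ) ∧
        Λ.map ((Matrix.toLin' (((gGL : GL (Fin 2) (w.1.adicCompletion L)) : Matrix (Fin 2) (Fin 2) (w.1.adicCompletion L)) - (g.trace * 2⁻¹) • (1 : Matrix (Fin 2) (Fin 2) (w.1.adicCompletion L)))).restrictScalars 𝒪[(w.1.adicCompletion L)]) ≤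
          Λ.map ((Matrix.toLin' ((toPlace v w (GaloisRepresentations.HeckeCharacter.uniformizer ↥(maximalRealSubfield L) v : v.adicCompletion ↥(maximalRealSubfield L)) : (w.1.adicCompletion L)) • (1 : Matrix (Fin 2) (Fin 2) (w.1.adicCompletion L)))).restrictScalars 𝒪[(w.1.adicCompletion L)])}.ncard =
      ∑ k ∈ range N, Nat.card (𝓞 ↥(maximalRealSubfield L) ⧸ v.asIdeal) ^ k := by
  classical
  have hϖv := Liu2021.LemD1IndexedNonVacuityInertCofinite.valued_toPlace_uniformizer_of_isUnramifiedIn L v hunr w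
  have hϖ : IsUniformizingElement (toPlace v w (GaloisRepresentations.HeckeCharacter.uniformizer ↥(maximalRealSubfield L) v : v.adicCompletion ↥(maximalRealSubfield L))) := isUniformizingElement_of_v_eq hϖv
  have h0 := hϖ.ne_zero
  haveI : IsDiscreteValuationRing 𝒪[(w.1.adicCompletion L)] := isDiscreteValuationRing_integer_of_compatible hϖv
  have hσv : ∀ x, valuation (w.1.adicCompletion L) ((galAdicCompletionMap (L := L) (IsCMField.complexConj L) hw) x) = valuation (w.1.adicCompletion L) x := fun x => valuation_galAdicCompletionMap_eq (IsCMField.complexConj L) v w hw x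
  have hσϖ : (galAdicCompletionMap (L := L) (IsCMField.complexConj L) hw) (toPlace v w (GaloisRepresentations.HeckeCharacter.uniformizer ↥(maximalRealSubfield L) v : v.adicCompletion ↥(maximalRealSubfield L))) = (toPlace v w (GaloisRepresentations.HeckeCharacter.uniformizer ↥(maximalRealSubfield L) v : v.adicCompletion ↥(maximalRealSubfield L))) := galAdicCompletionMap_toPlace (IsCMField.complexConj L) w w hw _
  -- `g₁₀ ≠ 0` (else `g₀₀` is a root of `χ_g`)
  have hg10 : g 1 0 ≠ 0 := fun h10 => hirr ⟨g 0 0, by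
    rw [Polynomial.IsRoot, Matrix.charpoly_fin_two, Matrix.trace_fin_two, Matrix.det_fin_two, h10]
    simp; ring⟩
  -- rescaling exponent: `|g₁₀| = |ϖ^m|`, `m = 2r + e`
  obtain ⟨m, hm⟩ := exists_valuation_eq_valuation_zpow hϖ hg10
  obtain ⟨r, e, he, hme⟩ : ∃ (r : ℤ) (e : ℕ), e ≤ 1 ∧ m = 2 * r + e := ⟨m / 2, (m % 2).toNat, by omega, by omega⟩
  obtain ⟨a, ha⟩ : ∃ a : (w.1.adicCompletion L), (toPlace v w (GaloisRepresentations.HeckeCharacter.uniformizer ↥(maximalRealSubfield L) v : v.adicCompletion ↥(maximalRealSubfield L))) ^ (-r) = a := ⟨_, rfl⟩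
  have ha0 : a ≠ 0 := by rw [← ha]; exact zpow_ne_zero _ h0
  have hσa : (galAdicCompletionMap (L := L) (IsCMField.complexConj L) hw) a = a := by rw [← ha, map_zpow₀, hσϖ]
  -- the rescaled isotropic cyclic frame (★ B-p10 §1)
  -- (projections instead of a nested `rcases` pattern: splitting the conjunction by `cases` against this goal exhausts the default heartbeats)
  have hex := exists_rescaled_cyclicFrame (galAdicCompletionMap (L := L) (IsCMField.complexConj L) hw) gGL g hcoe hgU hg10 ha0 hσa
  rcases hex with ⟨P', hP'⟩
  have hC' := hP'.1
  have hform' := hP'.2.1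
  have hdβ := hP'.2.2.1
  have htr := hP'.2.2.2
  -- valuations
  have hdv : valuation (w.1.adicCompletion L) g.det = 1 := by
    have h := congrArg (valuation (w.1.adicCompletion L)) hdβ
    rw [map_mul, Valuation.map_neg, hσv] at h
    exact mul_right_cancel₀ ((Valuation.ne_zero_iff _).2 hg10) (h.trans (one_mul _).symm)
  have hD : valuation (w.1.adicCompletion L) (g.trace ^ 2 - 4 * g.det) = valuation (w.1.adicCompletion L) ((toPlace v w (GaloisRepresentations.HeckeCharacter.uniformizer ↥(maximalRealSubfield L) v : v.adicCompletion ↥(maximalRealSubfield L))) ^ (2 * N + 1)) := by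
    refine (v_eq_iff_valuation_eq _ _).1 ?_
    rw [hN, map_pow, hϖv, ← WithZero.exp_nsmul]
    simp
  have hβ' : valuation (w.1.adicCompletion L) (a ^ 2 * g 1 0) = valuation (w.1.adicCompletion L) ((toPlace v w (GaloisRepresentations.HeckeCharacter.uniformizer ↥(maximalRealSubfield L) v : v.adicCompletion ↥(maximalRealSubfield L))) ^ e) := by
    rw [map_mul, hm, ← map_mul, ← ha, ← zpow_natCast ((toPlace v w (GaloisRepresentations.HeckeCharacter.uniformizer ↥(maximalRealSubfield L) v : v.adicCompletion ↥(maximalRealSubfield L))) ^ (-r)), ← _root_.zpow_mul, ← zpow_add₀ h0, ← zpow_natCast]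
    congr 2; push_cast; omega
  have htr' : a ^ 2 * g 1 0 * (galAdicCompletionMap (L := L) (IsCMField.complexConj L) hw) g.trace + (galAdicCompletionMap (L := L) (IsCMField.complexConj L) hw) (a ^ 2 * g 1 0) * g.trace = 0 := by
    rw [map_mul, map_pow, hσa]
    linear_combination a ^ 2 * htr
  -- REFINED transport (★ FILE A) and the interior count (§2)
  -- (the transported FORM is handed over as the binder `hH` of §2: no rewriting inside the refined set at the place)
  have hH : formCongr (galAdicCompletionMap (L := L) (IsCMField.complexConj L) hw) P' (placeForm (Matrix.of fun i j : Fin 2 => if i.val + j.val + 1 = 2 then (1 : L) else 0) w.1) = !![0, a ^ 2 * g 1 0; (galAdicCompletionMap (L := L) (IsCMField.complexConj L) hw) (a ^ 2 * g 1 0), 0] := by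
    rw [placeForm_antidiagTwo_eq_antidiag L v w]; exact hform'
  rw [ncard_selfDualStable_subSmul_congr (galAdicCompletionMap (L := L) (IsCMField.complexConj L) hw) (placeForm (Matrix.of fun i j : Fin 2 => if i.val + j.val + 1 = 2 then (1 : L) else 0) w.1) gGL P' (g.trace * 2⁻¹) (toPlace v w (GaloisRepresentations.HeckeCharacter.uniformizer ↥(maximalRealSubfield L) v : v.adicCompletion ↥(maximalRealSubfield L)) : (w.1.adicCompletion L))]
  exact ncard_selfDualStable_scalarReduction_antidiag_companion_eq_sum_at L v w hw hunr h2v ht hdv he hβ' hD htr' hH _ hC'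

include hw in
/-- **THE INTERIOR FIXED VERTICES, GROUP SIDE**: for a type-(2) `γ ∈ U_w = U(σ_w, (Φ₂)_w)` (`χ_γ` rootless in `L_w`, `tr γ ∈ 𝒪`, `|2| = 1`, `|tr² − 4det| = exp(−(2N+1))`),
the `γ`-fixed cosets `x ∈ U_w ⧸ K_w` whose local monodromy `(out x)⁻¹ γ (out x) ∈ K_w` is `≡ (tr γ∕2)·1 (mod ϖ)` number `Σ_(k < N) q_v^k`
(★ FILE A `natCard_fixedBy_unitary_subtype_eq_ncard` ∘ ★ self-dual docking ∘ the lattice count above). [cite: Kottwitz1988, §2] [cite: Flicker1998UnitaryFL, §6 p. 97] -/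
theorem natCard_fixedBy_subtype_scalar_eq_sum_of_unitary (hunr : Algebra.IsUnramifiedIn (𝓞 L) v.asIdeal) (γ : ↥(unitaryGroupOfForm (galAdicCompletionMap (L := L) (IsCMField.complexConj L) hw) (placeForm (Matrix.of fun i j : Fin 2 => if i.val + j.val + 1 = 2 then (1 : L) else 0) w.1)))
    (h2v : valuation (w.1.adicCompletion L) 2 = 1) (ht : (((γ : GL (Fin 2) (w.1.adicCompletion L))) : Matrix (Fin 2) (Fin 2) (w.1.adicCompletion L)).trace ∈ 𝒪[(w.1.adicCompletion L)])
    (hirr : ¬ ∃ x : (w.1.adicCompletion L), ((((γ : GL (Fin 2) (w.1.adicCompletion L))) : Matrix (Fin 2) (Fin 2) (w.1.adicCompletion L)).charpoly).IsRoot x)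
    (N : ℕ) (hN : Valued.v ((((γ : GL (Fin 2) (w.1.adicCompletion L))) : Matrix (Fin 2) (Fin 2) (w.1.adicCompletion L)).trace ^ 2 - 4 * (((γ : GL (Fin 2) (w.1.adicCompletion L))) : Matrix (Fin 2) (Fin 2) (w.1.adicCompletion L)).det) = WithZero.exp (-((2 * N + 1 : ℕ) : ℤ))) :
    Nat.card {x : MulAction.fixedBy (↥(unitaryGroupOfForm (galAdicCompletionMap (L := L) (IsCMField.complexConj L) hw) (placeForm (Matrix.of fun i j : Fin 2 => if i.val + j.val + 1 = 2 then (1 : L) else 0) w.1)) ⧸ ((glInt 2 (w.1.adicCompletion L)).subgroupOf (unitaryGroupOfForm (galAdicCompletionMap (L := L) (IsCMField.complexConj L) hw) (placeForm (Matrix.of fun i j : Fin 2 => if i.val + j.val + 1 = 2 then (1 : L) else 0) w.1)))) γ //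
        ∀ i j, ((toPlace v w (GaloisRepresentations.HeckeCharacter.uniformizer ↥(maximalRealSubfield L) v : v.adicCompletion ↥(maximalRealSubfield L)) : (w.1.adicCompletion L))⁻¹ • (((((x.1.out : ↥(unitaryGroupOfForm (galAdicCompletionMap (L := L) (IsCMField.complexConj L) hw) (placeForm (Matrix.of fun i j : Fin 2 => if i.val + j.val + 1 = 2 then (1 : L) else 0) w.1))) : GL (Fin 2) (w.1.adicCompletion L))⁻¹ : GL (Fin 2) (w.1.adicCompletion L)) : Matrix (Fin 2) (Fin 2) (w.1.adicCompletion L)) *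
          ((((γ : GL (Fin 2) (w.1.adicCompletion L))) : Matrix (Fin 2) (Fin 2) (w.1.adicCompletion L)) - ((((γ : GL (Fin 2) (w.1.adicCompletion L))) : Matrix (Fin 2) (Fin 2) (w.1.adicCompletion L)).trace * 2⁻¹) • (1 : Matrix (Fin 2) (Fin 2) (w.1.adicCompletion L))) *
          (((x.1.out : ↥(unitaryGroupOfForm (galAdicCompletionMap (L := L) (IsCMField.complexConj L) hw) (placeForm (Matrix.of fun i j : Fin 2 => if i.val + j.val + 1 = 2 then (1 : L) else 0) w.1))) : GL (Fin 2) (w.1.adicCompletion L)) : Matrix (Fin 2) (Fin 2) (w.1.adicCompletion L)))) i j ∈ 𝒪[(w.1.adicCompletion L)]} =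
      ∑ k ∈ range N, Nat.card (𝓞 ↥(maximalRealSubfield L) ⧸ v.asIdeal) ^ k := by
  have hc1 : IsCMField.complexConj L ≠ 1 := IsCMField.complexConj_ne_one L
  have hϖv := Liu2021.LemD1IndexedNonVacuityInertCofinite.valued_toPlace_uniformizer_of_isUnramifiedIn L v hunr w
  have hϖ : IsUniformizingElement (toPlace v w (GaloisRepresentations.HeckeCharacter.uniformizer ↥(maximalRealSubfield L) v : v.adicCompletion ↥(maximalRealSubfield L))) := isUniformizingElement_of_v_eq hϖv
  have hgU : ((((γ : GL (Fin 2) (w.1.adicCompletion L))) : Matrix (Fin 2) (Fin 2) (w.1.adicCompletion L)).map (galAdicCompletionMap (L := L) (IsCMField.complexConj L) hw))ᵀ * (!![0, 1; 1, 0] : Matrix (Fin 2) (Fin 2) (w.1.adicCompletion L)) * (((γ : GL (Fin 2) (w.1.adicCompletion L))) : Matrix (Fin 2) (Fin 2) (w.1.adicCompletion L)) = !![0, 1; 1, 0] := by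
    rw [← placeForm_antidiagTwo_eq_antidiag L v w]; exact mem_unitaryGroupOfForm_iff.1 γ.2
  rw [natCard_fixedBy_unitary_subtype_eq_ncard (galAdicCompletionMap (L := L) (IsCMField.complexConj L) hw) (placeForm (Matrix.of fun i j : Fin 2 => if i.val + j.val + 1 = 2 then (1 : L) else 0) w.1) γ
      ((((γ : GL (Fin 2) (w.1.adicCompletion L))) : Matrix (Fin 2) (Fin 2) (w.1.adicCompletion L)) - ((((γ : GL (Fin 2) (w.1.adicCompletion L))) : Matrix (Fin 2) (Fin 2) (w.1.adicCompletion L)).trace * 2⁻¹) • (1 : Matrix (Fin 2) (Fin 2) (w.1.adicCompletion L))) hϖ.ne_zero,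
    ← ncard_selfDualStable_scalarReduction_antidiagTwo_eq_sum_of_unitary L v w hw hunr (γ : GL (Fin 2) (w.1.adicCompletion L)) (((γ : GL (Fin 2) (w.1.adicCompletion L))) : Matrix (Fin 2) (Fin 2) (w.1.adicCompletion L)) rfl hgU h2v ht hirr N hN]
  -- (no `rw` under the refined predicate at the place: plain `and_congr_left'` on the docking equivalence)
  congr 1
  ext Λ
  exact and_congr_left' (and_congr_left' (exists_mem_unitary_span_eq_iff_selfDual_of_nonsplit L 2 _ hc1 w hw hunr (antidiagOne_isHermitian L 2)
    (isUnit_placeForm_antidiagOne (E := L) 2 w.1) (unit_placeForm_antidiagOne_mem_glInt (E := L) 2 w.1) Λ))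

set_option maxHeartbeats 400000 in
include hw in
/-- **THE FIXED VERTICES**: `#Fix_γ(U_w ⧸ K_w) = Σ_(k ≤ N) q_v^k` for a type-(2) `γ ∈ U_w` (★ FILE A fixed-coset dictionary with the vacuous predicate ∘ ★ docking ∘ ★
`ncard_selfDualStable_antidiagTwo_eq_sum_of_unitary`). [cite: Kottwitz1988, §2] [cite: Flicker1998UnitaryFL, §6 p. 97] -/
theorem natCard_fixedBy_glInt_eq_sum_of_unitary (hunr : Algebra.IsUnramifiedIn (𝓞 L) v.asIdeal) (γ : ↥(unitaryGroupOfForm (galAdicCompletionMap (L := L) (IsCMField.complexConj L) hw) (placeForm (Matrix.of fun i j : Fin 2 => if i.val + j.val + 1 = 2 then (1 : L) else 0) w.1)))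
    (h2v : valuation (w.1.adicCompletion L) 2 = 1) (ht : (((γ : GL (Fin 2) (w.1.adicCompletion L))) : Matrix (Fin 2) (Fin 2) (w.1.adicCompletion L)).trace ∈ 𝒪[(w.1.adicCompletion L)])
    (hirr : ¬ ∃ x : (w.1.adicCompletion L), ((((γ : GL (Fin 2) (w.1.adicCompletion L))) : Matrix (Fin 2) (Fin 2) (w.1.adicCompletion L)).charpoly).IsRoot x)
    (N : ℕ) (hN : Valued.v ((((γ : GL (Fin 2) (w.1.adicCompletion L))) : Matrix (Fin 2) (Fin 2) (w.1.adicCompletion L)).trace ^ 2 - 4 * (((γ : GL (Fin 2) (w.1.adicCompletion L))) : Matrix (Fin 2) (Fin 2) (w.1.adicCompletion L)).det) = WithZero.exp (-((2 * N + 1 : ℕ) : ℤ))) :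
    Nat.card (MulAction.fixedBy (↥(unitaryGroupOfForm (galAdicCompletionMap (L := L) (IsCMField.complexConj L) hw) (placeForm (Matrix.of fun i j : Fin 2 => if i.val + j.val + 1 = 2 then (1 : L) else 0) w.1)) ⧸ ((glInt 2 (w.1.adicCompletion L)).subgroupOf (unitaryGroupOfForm (galAdicCompletionMap (L := L) (IsCMField.complexConj L) hw) (placeForm (Matrix.of fun i j : Fin 2 => if i.val + j.val + 1 = 2 then (1 : L) else 0) w.1)))) γ) = ∑ k ∈ range (N + 1), Nat.card (𝓞 ↥(maximalRealSubfield L) ⧸ v.asIdeal) ^ k := by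
  have hc1 : IsCMField.complexConj L ≠ 1 := IsCMField.complexConj_ne_one L
  have hgU : ((((γ : GL (Fin 2) (w.1.adicCompletion L))) : Matrix (Fin 2) (Fin 2) (w.1.adicCompletion L)).map (galAdicCompletionMap (L := L) (IsCMField.complexConj L) hw))ᵀ * (!![0, 1; 1, 0] : Matrix (Fin 2) (Fin 2) (w.1.adicCompletion L)) * (((γ : GL (Fin 2) (w.1.adicCompletion L))) : Matrix (Fin 2) (Fin 2) (w.1.adicCompletion L)) = !![0, 1; 1, 0] := by
    rw [← placeForm_antidiagTwo_eq_antidiag L v w]; exact mem_unitaryGroupOfForm_iff.1 γ.2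
  have hϖv := Liu2021.LemD1IndexedNonVacuityInertCofinite.valued_toPlace_uniformizer_of_isUnramifiedIn L v hunr w
  have hϖ : IsUniformizingElement (toPlace v w (GaloisRepresentations.HeckeCharacter.uniformizer ↥(maximalRealSubfield L) v : v.adicCompletion ↥(maximalRealSubfield L))) := isUniformizingElement_of_v_eq hϖv
  -- ★ FILE A `natCard_fixedBy_unitary_subtype_eq_ncard` with `A := 0`: the extra predicate is vacuous on both sides
  have h := natCard_fixedBy_unitary_subtype_eq_ncard (galAdicCompletionMap (L := L) (IsCMField.complexConj L) hw) (placeForm (Matrix.of fun i j : Fin 2 => if i.val + j.val + 1 = 2 then (1 : L) else 0) w.1) γ 0 hϖ.ne_zero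
  have e1 : Nat.card {x : MulAction.fixedBy (↥(unitaryGroupOfForm (galAdicCompletionMap (L := L) (IsCMField.complexConj L) hw) (placeForm (Matrix.of fun i j : Fin 2 => if i.val + j.val + 1 = 2 then (1 : L) else 0) w.1)) ⧸ ((glInt 2 (w.1.adicCompletion L)).subgroupOf (unitaryGroupOfForm (galAdicCompletionMap (L := L) (IsCMField.complexConj L) hw) (placeForm (Matrix.of fun i j : Fin 2 => if i.val + j.val + 1 = 2 then (1 : L) else 0) w.1)))) γ //
      ∀ i j, (((toPlace v w (GaloisRepresentations.HeckeCharacter.uniformizer ↥(maximalRealSubfield L) v : v.adicCompletion ↥(maximalRealSubfield L))))⁻¹ • (((((x.1.out : ↥(unitaryGroupOfForm (galAdicCompletionMap (L := L) (IsCMField.complexConj L) hw) (placeForm (Matrix.of fun i j : Fin 2 => if i.val + j.val + 1 = 2 then (1 : L) else 0) w.1))) : GL (Fin 2) (w.1.adicCompletion L))⁻¹ : GL (Fin 2) (w.1.adicCompletion L)) : Matrix (Fin 2) (Fin 2) (w.1.adicCompletion L)) *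
          (0 : Matrix (Fin 2) (Fin 2) (w.1.adicCompletion L)) * (((x.1.out : ↥(unitaryGroupOfForm (galAdicCompletionMap (L := L) (IsCMField.complexConj L) hw) (placeForm (Matrix.of fun i j : Fin 2 => if i.val + j.val + 1 = 2 then (1 : L) else 0) w.1))) : GL (Fin 2) (w.1.adicCompletion L)) : Matrix (Fin 2) (Fin 2) (w.1.adicCompletion L)))) i j ∈ 𝒪[(w.1.adicCompletion L)]} =
      Nat.card (MulAction.fixedBy (↥(unitaryGroupOfForm (galAdicCompletionMap (L := L) (IsCMField.complexConj L) hw) (placeForm (Matrix.of fun i j : Fin 2 => if i.val + j.val + 1 = 2 then (1 : L) else 0) w.1)) ⧸ ((glInt 2 (w.1.adicCompletion L)).subgroupOf (unitaryGroupOfForm (galAdicCompletionMap (L := L) (IsCMField.complexConj L) hw) (placeForm (Matrix.of fun i j : Fin 2 => if i.val + j.val + 1 = 2 then (1 : L) else 0) w.1)))) γ) :=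
    Nat.card_congr (Equiv.subtypeUnivEquiv fun x i j => by rw [Matrix.mul_zero, Matrix.zero_mul, smul_zero]; exact zero_mem _)
  rw [← e1, h, ← ncard_selfDualStable_antidiagTwo_eq_sum_of_unitary L v w hw hunr (γ : GL (Fin 2) (w.1.adicCompletion L)) (((γ : GL (Fin 2) (w.1.adicCompletion L))) : Matrix (Fin 2) (Fin 2) (w.1.adicCompletion L)) rfl hgU h2v ht hirr N hN]
  congr 1
  ext Λ
  simp only [Set.mem_setOf_eq, map_zero, LinearMap.restrictScalars_zero, Submodule.map_zero, bot_le, and_true]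
  rw [exists_mem_unitary_span_eq_iff_selfDual_of_nonsplit L 2 _ hc1 w hw hunr (antidiagOne_isHermitian L 2)
    (isUnit_placeForm_antidiagOne (E := L) 2 w.1) (unit_placeForm_antidiagOne_mem_glInt (E := L) 2 w.1) Λ]

end Count

/-! ## §5 THE HEAD: the type-(2) edge count at an inert place -/

section Head

variable (L : Type) [Field L] [NumberField L] [IsCMField L] (v : HeightOneSpectrum (𝓞 ↥(maximalRealSubfield L)))
  (w : PlacesOver L v) (hw : IsCMField.complexConj L • w.1 = w.1)

omit [IsCMField L] in
/-- `Σ_(k ≤ N) q^k = q · Σ_(k < N) q^k + 1`. [cite: Kottwitz1988, §2] -/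
private theorem sum_range_succ_pow_eq (q N : ℕ) : ∑ k ∈ range (N + 1), q ^ k = q * ∑ k ∈ range N, q ^ k + 1 := by
  rw [Finset.sum_range_succ', pow_zero, Finset.mul_sum]
  congr 1
  exact Finset.sum_congr rfl fun k _ => by rw [pow_succ, mul_comm]

include hw in
/-- **KOTTWITZ'S EDGE COUNT FOR A TYPE-(2) ELLIPTIC ELEMENT: `#Fix_γ(U_w ⧸ I_w) + 1 = 2 · Σ_(k ≤ N) q_v^k`.**  At a finite place `v` of `L⁺` inert and unramified in the CM
field `L` (`w ∣ v`, `c • w = w`), for `γ ∈ U_w = U(σ_w, (Φ₂)_w)` with `χ_γ` WITHOUT ROOT in `L_w`, `tr γ ∈ 𝒪_w`, `|2|_w = 1` and `|tr² − 4 det|_w = exp(−(2N+1))`, the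
`γ`-fixed edges of the tree (`I_w = U_w ∩ Iwahori`) number `2·Σ_(k≤N) q_v^k − 1`: §4 `natCard_fixedBy_iwahori_eq_add_mul_of_sq_eq_smul_one` at `a = tr γ∕2`, `e = (tr² − 4det)∕4`
(★ FILE A `sub_smul_one_mul_self_eq_smul_one`; `|σ(a)a − 1| < 1` by §1 over the cyclic-frame relations ★ `exists_rescaled_cyclicFrame`) gives `E₂ = V + q·S`; `V = Σ_(k≤N) q^k`
(§3 `natCard_fixedBy_glInt_eq_sum_of_unitary`), `S = Σ_(k<N) q^k` (§3 `natCard_fixedBy_subtype_scalar_eq_sum_of_unitary`, the two scalar-reduction predicates agreeing through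
`k̄ = ā·1`: ★ `coe_glIntReduction_eq_smul_one_iff` ∕ ★ `glIntReduction_eq_smul_one_iff`), `#{τt = −t} = q` (★ `natCard_antifixed_residueField_eq`), and `Σ_(k≤N) q^k = q·Σ_(k<N) q^k + 1`.
With `V_K = V_{K′} = Σ_(k≤N) q^k` this is the Euler characteristic `V_K + V_{K′} − E₂ = 1` of the fixed subtree — the type-(2) elliptic row of (R2) [Kottwitz1988 §2 Thm 2].
[cite: Kottwitz1988, §2 Theorem 2] [cite: Rogawski1990, §12.6 p. 174] -/
theorem natCard_fixedBy_iwahori_add_one_eq_two_mul_sum_of_not_exists_isRoot (hunr : Algebra.IsUnramifiedIn (𝓞 L) v.asIdeal) (γ : ↥(unitaryGroupOfForm (galAdicCompletionMap (L := L) (IsCMField.complexConj L) hw) (placeForm (Matrix.of fun i j : Fin 2 => if i.val + j.val + 1 = 2 then (1 : L) else 0) w.1)))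
    (h2v : valuation (w.1.adicCompletion L) 2 = 1) (ht : (((γ : GL (Fin 2) (w.1.adicCompletion L))) : Matrix (Fin 2) (Fin 2) (w.1.adicCompletion L)).trace ∈ 𝒪[(w.1.adicCompletion L)])
    (hirr : ¬ ∃ x : (w.1.adicCompletion L), ((((γ : GL (Fin 2) (w.1.adicCompletion L))) : Matrix (Fin 2) (Fin 2) (w.1.adicCompletion L)).charpoly).IsRoot x)
    (N : ℕ) (hN : Valued.v ((((γ : GL (Fin 2) (w.1.adicCompletion L))) : Matrix (Fin 2) (Fin 2) (w.1.adicCompletion L)).trace ^ 2 - 4 * (((γ : GL (Fin 2) (w.1.adicCompletion L))) : Matrix (Fin 2) (Fin 2) (w.1.adicCompletion L)).det) = WithZero.exp (-((2 * N + 1 : ℕ) : ℤ))) :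
    Nat.card (MulAction.fixedBy (↥(unitaryGroupOfForm (galAdicCompletionMap (L := L) (IsCMField.complexConj L) hw) (placeForm (Matrix.of fun i j : Fin 2 => if i.val + j.val + 1 = 2 then (1 : L) else 0) w.1)) ⧸ ((iwahoriGL 2 (w.1.adicCompletion L)).subgroupOf (unitaryGroupOfForm (galAdicCompletionMap (L := L) (IsCMField.complexConj L) hw) (placeForm (Matrix.of fun i j : Fin 2 => if i.val + j.val + 1 = 2 then (1 : L) else 0) w.1)))) γ) + 1 = 2 * ∑ k ∈ range (N + 1), Nat.card (𝓞 ↥(maximalRealSubfield L) ⧸ v.asIdeal) ^ k := by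
  classical
  -- the place: uniformizer, DVR, the integral involution `σO`, its reduction `σk`, `|𝓀| = q²`, the moved integer `a₀`
  have hc1 : IsCMField.complexConj L ≠ 1 := IsCMField.complexConj_ne_one L
  have hϖv := Liu2021.LemD1IndexedNonVacuityInertCofinite.valued_toPlace_uniformizer_of_isUnramifiedIn L v hunr w
  have hϖ : IsUniformizingElement (toPlace v w (GaloisRepresentations.HeckeCharacter.uniformizer ↥(maximalRealSubfield L) v : v.adicCompletion ↥(maximalRealSubfield L))) := isUniformizingElement_of_v_eq hϖv
  have h0 := hϖ.ne_zero
  haveI : IsDiscreteValuationRing 𝒪[(w.1.adicCompletion L)] := isDiscreteValuationRing_integer_of_compatible hϖv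
  have hσO : ∀ x : 𝒪[(w.1.adicCompletion L)], (galAdicCompletionMap (L := L) (IsCMField.complexConj L) hw) x ∈ 𝒪[(w.1.adicCompletion L)] := mem_integer_galAdicCompletionMap (IsCMField.complexConj L) v w hw
  let σO : 𝒪[(w.1.adicCompletion L)] →+* 𝒪[(w.1.adicCompletion L)] := (((galAdicCompletionMap (L := L) (IsCMField.complexConj L) hw)).comp (𝒪[(w.1.adicCompletion L)]).subtype).codRestrict 𝒪[(w.1.adicCompletion L)] fun x => hσO x
  have hσO' : ∀ x : 𝒪[(w.1.adicCompletion L)], ((σO x : 𝒪[(w.1.adicCompletion L)]) : (w.1.adicCompletion L)) = (galAdicCompletionMap (L := L) (IsCMField.complexConj L) hw) x := fun _ => rfl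
  have hσσ : ∀ x, σO (σO x) = x := fun x =>
    Subtype.ext (galAdicCompletionMap_galAdicCompletionMap_of_smul_eq (IsCMField.complexConj L) w hc1 hw (x : (w.1.adicCompletion L)))
  have hσv : ∀ x, valuation (w.1.adicCompletion L) ((galAdicCompletionMap (L := L) (IsCMField.complexConj L) hw) x) = valuation (w.1.adicCompletion L) x := fun x => valuation_galAdicCompletionMap_eq (IsCMField.complexConj L) v w hw x
  obtain ⟨σk, hσk⟩ := exists_residueField_ringHom_galAdicCompletionMap (IsCMField.complexConj L) v w hw
  have hτ : ∀ x : 𝒪[(w.1.adicCompletion L)], IsLocalRing.residue 𝒪[(w.1.adicCompletion L)] (σO x) = σk (IsLocalRing.residue 𝒪[(w.1.adicCompletion L)] x) := fun x => hσk x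
  have hq : Nat.card 𝓀[(w.1.adicCompletion L)] = Nat.card (𝓞 ↥(maximalRealSubfield L) ⧸ v.asIdeal) ^ 2 := natCard_residueField_eq_sq_of_inert (IsCMField.complexConj L) v hc1 hunr w hw
  letI : Fintype 𝓀[(w.1.adicCompletion L)] := Fintype.ofFinite _
  have hq' : Fintype.card 𝓀[(w.1.adicCompletion L)] = Nat.card (𝓞 ↥(maximalRealSubfield L) ⧸ v.asIdeal) ^ 2 := by rw [← Nat.card_eq_fintype_card, hq]
  obtain ⟨a₀, ha₀⟩ := LocalFields.UnramifiedQuadraticNorm.exists_isUnit_map_sub_of_residueHom_ne (galAdicCompletionMap (L := L) (IsCMField.complexConj L) hw) hσO σk hσk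
    (Literature.LinearAlgebra.Matrix.exists_frob_ne hq' σk (residueHom_galAdicCompletionMap_eq_pow (IsCMField.complexConj L) v hc1 hunr w hw σk hσO hσk))
  have ha₀' : IsUnit (σO a₀ - a₀) := ha₀
  have hs : Nat.card {t : 𝓀[(w.1.adicCompletion L)] // σk t = -t} = Nat.card (𝓞 ↥(maximalRealSubfield L) ⧸ v.asIdeal) := natCard_antifixed_residueField_eq σO hσσ ha₀' σk hτ hq
  -- the square relation `(γ − a·1)² = e·1`, `a = tr∕2`, `e = (tr² − 4det)∕4`, `|e| < 1`
  have h20 : (2 : (w.1.adicCompletion L)) ≠ 0 := fun h => by rw [h, map_zero] at h2v; exact zero_ne_one h2v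
  have h2i : valuation (w.1.adicCompletion L) (2 : (w.1.adicCompletion L))⁻¹ = 1 := by rw [map_inv₀, h2v, inv_one]
  have h4i : valuation (w.1.adicCompletion L) (4 : (w.1.adicCompletion L))⁻¹ = 1 := by
    rw [show (4 : (w.1.adicCompletion L)) = 2 * 2 by norm_num, mul_inv, map_mul, h2i, one_mul]
  have haO : (((γ : GL (Fin 2) (w.1.adicCompletion L))) : Matrix (Fin 2) (Fin 2) (w.1.adicCompletion L)).trace * 2⁻¹ ∈ 𝒪[(w.1.adicCompletion L)] := mul_mem ht ((Valuation.mem_integer_iff _ _).2 h2i.le)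
  have hDlt : valuation (w.1.adicCompletion L) ((((γ : GL (Fin 2) (w.1.adicCompletion L))) : Matrix (Fin 2) (Fin 2) (w.1.adicCompletion L)).trace ^ 2 - 4 * (((γ : GL (Fin 2) (w.1.adicCompletion L))) : Matrix (Fin 2) (Fin 2) (w.1.adicCompletion L)).det) < 1 := by
    rw [← v_lt_one_iff_valuation_lt_one, hN, ← WithZero.exp_zero, WithZero.exp_lt_exp]
    omega
  have heO : ((((γ : GL (Fin 2) (w.1.adicCompletion L))) : Matrix (Fin 2) (Fin 2) (w.1.adicCompletion L)).trace ^ 2 - 4 * (((γ : GL (Fin 2) (w.1.adicCompletion L))) : Matrix (Fin 2) (Fin 2) (w.1.adicCompletion L)).det) * 4⁻¹ ∈ 𝒪[(w.1.adicCompletion L)] :=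
    mul_mem ((Valuation.mem_integer_iff _ _).2 hDlt.le) ((Valuation.mem_integer_iff _ _).2 h4i.le)
  have helt : valuation (w.1.adicCompletion L) ((((((γ : GL (Fin 2) (w.1.adicCompletion L))) : Matrix (Fin 2) (Fin 2) (w.1.adicCompletion L)).trace ^ 2 -
      4 * (((γ : GL (Fin 2) (w.1.adicCompletion L))) : Matrix (Fin 2) (Fin 2) (w.1.adicCompletion L)).det) * 4⁻¹)) < 1 := by
    rw [map_mul, h4i, mul_one]; exact hDlt
  have hsq := sub_smul_one_mul_self_eq_smul_one h20 (((γ : GL (Fin 2) (w.1.adicCompletion L))) : Matrix (Fin 2) (Fin 2) (w.1.adicCompletion L))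
  -- the residual norm of `a` from the cyclic-frame relations (★ `exists_rescaled_cyclicFrame` at the trivial rescaling `a = 1`)
  have hgU : ((((γ : GL (Fin 2) (w.1.adicCompletion L))) : Matrix (Fin 2) (Fin 2) (w.1.adicCompletion L)).map (galAdicCompletionMap (L := L) (IsCMField.complexConj L) hw))ᵀ * (!![0, 1; 1, 0] : Matrix (Fin 2) (Fin 2) (w.1.adicCompletion L)) * (((γ : GL (Fin 2) (w.1.adicCompletion L))) : Matrix (Fin 2) (Fin 2) (w.1.adicCompletion L)) = !![0, 1; 1, 0] := by
    rw [← placeForm_antidiagTwo_eq_antidiag L v w]; exact mem_unitaryGroupOfForm_iff.1 γ.2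
  have hg10 : (((γ : GL (Fin 2) (w.1.adicCompletion L))) : Matrix (Fin 2) (Fin 2) (w.1.adicCompletion L)) 1 0 ≠ 0 := fun h10 => hirr ⟨(((γ : GL (Fin 2) (w.1.adicCompletion L))) : Matrix (Fin 2) (Fin 2) (w.1.adicCompletion L)) 0 0, by
    rw [Polynomial.IsRoot, Matrix.charpoly_fin_two, Matrix.trace_fin_two, Matrix.det_fin_two, h10]
    simp; ring⟩
  have hex := exists_rescaled_cyclicFrame (galAdicCompletionMap (L := L) (IsCMField.complexConj L) hw) (γ : GL (Fin 2) (w.1.adicCompletion L)) (((γ : GL (Fin 2) (w.1.adicCompletion L))) : Matrix (Fin 2) (Fin 2) (w.1.adicCompletion L)) rfl hgU hg10 (one_ne_zero) (map_one (galAdicCompletionMap (L := L) (IsCMField.complexConj L) hw))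
  rcases hex with ⟨P', hP'⟩
  have hdβ := hP'.2.2.1
  have htr := hP'.2.2.2
  have hnorm : valuation (w.1.adicCompletion L) ((galAdicCompletionMap (L := L) (IsCMField.complexConj L) hw)
      ((((γ : GL (Fin 2) (w.1.adicCompletion L))) : Matrix (Fin 2) (Fin 2) (w.1.adicCompletion L)).trace * 2⁻¹) *
      ((((γ : GL (Fin 2) (w.1.adicCompletion L))) : Matrix (Fin 2) (Fin 2) (w.1.adicCompletion L)).trace * 2⁻¹) - 1) < 1 := by
    rw [map_half_trace_mul_sub_one_eq (galAdicCompletionMap (L := L) (IsCMField.complexConj L) hw) hg10 h20 hdβ htr, map_mul, Valuation.map_neg, map_mul, map_inv₀, hσv,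
      mul_inv_cancel₀ ((Valuation.ne_zero_iff _).2 hg10), one_mul, map_mul, h4i, mul_one]
    exact hDlt
  -- the vertex count `V = Σ_(k ≤ N) q^k` and finiteness of the fixed vertices
  have hV := natCard_fixedBy_glInt_eq_sum_of_unitary L v w hw hunr γ h2v ht hirr N hN
  have hVpos : ∑ k ∈ range (N + 1), Nat.card (𝓞 ↥(maximalRealSubfield L) ⧸ v.asIdeal) ^ k ≠ 0 := by
    rw [Finset.sum_range_succ', pow_zero]; exact Nat.succ_ne_zero _
  haveI : Finite (MulAction.fixedBy (↥(unitaryGroupOfForm (galAdicCompletionMap (L := L) (IsCMField.complexConj L) hw) (placeForm (Matrix.of fun i j : Fin 2 => if i.val + j.val + 1 = 2 then (1 : L) else 0) w.1)) ⧸ ((glInt 2 (w.1.adicCompletion L)).subgroupOf (unitaryGroupOfForm (galAdicCompletionMap (L := L) (IsCMField.complexConj L) hw) (placeForm (Matrix.of fun i j : Fin 2 => if i.val + j.val + 1 = 2 then (1 : L) else 0) w.1)))) γ) := Nat.finite_of_card_ne_zero (by rw [hV]; exact hVpos)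
  -- §4: `E₂ = V + s · S`
  have hE := natCard_fixedBy_iwahori_eq_add_mul_of_sq_eq_smul_one (galAdicCompletionMap (L := L) (IsCMField.complexConj L) hw) σO hσO' hσσ ha₀' σk hτ
    (placeForm_antidiagTwo_eq_antidiag L v w) γ haO heO helt hsq hnorm
  -- `S = Σ_(k < N) q^k`: the valuation predicate of §4 is the `ϖ`-predicate of §3 (both say `k̄_x = ā·1`, generic bridge of §4)
  have hS := (natCard_subtype_valuation_eq_natCard_subtype_inv_smul (galAdicCompletionMap (L := L) (IsCMField.complexConj L) hw) hϖ γ haO).trans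
    (natCard_fixedBy_subtype_scalar_eq_sum_of_unitary L v w hw hunr γ h2v ht hirr N hN)
  -- `E₂ + 1 = V + q·S + 1 = 2V` (`V = q·S + 1`)
  have hPS := sum_range_succ_pow_eq (Nat.card (𝓞 ↥(maximalRealSubfield L) ⧸ v.asIdeal)) N
  -- (term-mode substitution of the three counts: no `rw` next to the place-level subtype terms)
  have h3 := congr (congrArg HAdd.hAdd hV) (congr (congrArg HMul.hMul hs) hS)
  omega

end Head

end Literature.NumberTheory.Automorphic.UnitaryGroup

end
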